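import Literature.MathematicalPhysics.QuantumFieldTheory.Balaban1983to89.B15Claim129Step
import Literature.MathematicalPhysics.QuantumFieldTheory.Balaban1983to89.B15Chi124DetSets
import Literature.MathematicalPhysics.QuantumFieldTheory.Balaban1983to89.B15SmallField185

/-!
# `Balaban1983to89.B15Claim129Assembly` — T. Bałaban, *Large field renormalization. I. The basic step of the 𝐑 operation*,
# Commun. Math. Phys. **122** (1989) 175–202 [Balaban1989LargeFieldI] = «[IV]», (1.29) p. 183 (proof pp. 183–187): THE ONE-THEOREM
# ASSEMBLY — *"the restrictions introduced by the new characteristic functions imply that the functions (1.3), (1.4), (1.5),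
# (1.7), (1.8), χ_k^{(n)} are equal to 1"* — in the typed implication form `B15.BasicStep.Claim129 new old` with `old` THE
# CONJUNCTION OF ALL SIX FACTOR FAMILIES, knitted BY NAME from the tree's factor theorems over their printed leaves; and the
# `χ_k^{(n)}`-factor CONCRETE on r12's regions (`B15Chi124DetSets.Chi124` at level `j` from `Chi124` at level `j + 1` + (1.48))

statement-level skeleton of published theorems with citation tags; proofs where landed; nothing here is a claim about
the Yang–Mills mass gap

PDF held: `paper:balaban1989-cmp122-large-field-i` (journal page = PDF page + 174).  (1.29) and the proof text pp. 183–187 were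
READ AS IMAGES by this seat on the ×2 renders `run/shared/lean/pub/pub-balaban/b2b-balaban-ref1/pages/1989-cmp122-large-field-I/
1989-cmp122-large-field-I-p009-x2.png` (p. 183), `…-p013-x2.png` (p. 187); pp. 184–186 through the docstrings of the factor files
(render-verified by r12, QUOTE-AUDIT-B15).  [III] = [Balaban1988Convergent] (CMP 119), [12] = [Balaban1985Averaging] (CMP 98).

CITATION HEADER / WHAT IS REPRODUCED (mega-formalization `lit-balaban`, HOME `run/shared/lean/pub/lit-balaban/`; Phase-2 proof
seat `lit-balaban-p29` gen 41 under the free-target protocol G.5-34 (d); block B15, fold owner r12 (auto-wake-gated), PROXY r11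
under G.5-61).  SKELETON row served: **B15.Eq1.29** — r12's `lit-balaban-r12/ROWS-B15.md` v7.111 cell, verbatim: *"STATE OF THE
ROW: all five factor families are kernel theorems over their printed analytic leaves — (1.3)/(1.4) `B15SmallField185.sf13_of_131`
(leaf (1.30)+[III](3.8)), (1.5) `B15Claim184` (leaves (1.33)–(1.36)), (1.7)/(1.8) `sf17_of_reps`/`sf18_of_reps` (leaves
(1.40)–(1.41)), χ_k^{(n)} `lines124_step` (leaves (1.45)–(1.47)); head kept (one-theorem assembly = remaining bookkeeping)"*.
THIS FILE IS THAT ASSEMBLY (cells; the head is the owner's ∕ lead's business).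

THE PRINT (p. 183 [PDF 9], verbatim): *"Now we will prove that the restrictions introduced by the new characteristic functions
imply that the functions (1.3), (1.4), (1.5), (1.7), (1.8), χ_k^{(n)} are equal to 1. More precisely, we have
χ_k^{(n+1)}χ(Z_{j+1}∩Ω_{j+1})(Π_{□′⊂Ω_{j+1}∖Ω^{∼−1}_{j+1}} χ^{(j)}_{□′})ζ(Ω^c_{j+1})χ′_jχ_k^{(n)} · (Π_{y∈((Ω^{∼3}_{j+1})ᶜ∖Z″_{j+1})^{(j+1)}}
Π_{x∈B(y),x≠y} χ({|V_j(x,y) − 1| < ε_j})(1/z)exp[−g_j⁻²[1 − Re tr V_j(x,y)]]) = χ_k^{(n+1)}(Π_{□′⊂Z_{j+1}∩Ω_{j+1}} χ^{(j)}_{□′})χ′_j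
· (Π_{y∈(Ω^c_{j+1}∖Z″_{j+1})^{(j+1)}} Π_{x∈B(y),x≠y} (1/z)exp[−g_j⁻²[1 − Re tr V_j(x,y)]]) (1.29) for j + 1 < k, and for j + 1 = k the
right-hand side above is multiplied by χ_k(Ω_k^{∼4})."*  p. 187 [PDF 13]: *"Thus taking α = 1/8 in (1.48) we satisfy all the
conditions. We have proved that the function χ_k^{(n)} in (1.29) is equal to 1. This completes the proof of the equality (1.29)."*
(`χ(Z_{j+1}∩Ω_{j+1})ζ(Ω^c_{j+1})` = the product of the seven groups (1.3)–(1.9), p. 178; the NEW restrictions are `χ_k^{(n+1)}`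
(1.24), the functions `χ^{(j)}_{□′}` (1.9) and `χ′_j` (1.27); the gauge-fixing densities (1.6) and the functions (1.9) stand on
both sides.)

WHAT IS PROVED (theorems only; 0 `def … : Prop` facts, 0 `sorry`, standard axioms).
§1 `plaqsOf_union_subset` — bookkeeping for the plaquette convention of r12's regions (p40's `B8Eq17ClassAkV1.plaqsOf`, [12] p. 77).
§2 **`chi124_of_succ`** (core form `chi124_of_succ_of_topLine`, `j + 1 ≦ k`, with the level-`(n+1)` line on `Ω_j∖Ω_{j+1}` as a
separate input) — THE `χ_k^{(n)}` FACTOR CONCRETE: on r12's multi-scale point-set model (`B15DeterminingSets` regions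
`Ω_j, Z″_j ⊂ T_η`; `B15Chi124DetSets.Chi124` = (1.24) second case as a functional of a configuration), for `h ≦ k₀`,
`k₀ + 2 ≦ j`, `j + 1 < k` (print's displayed, non-degenerate case, cf. r12's READING (a) of `B15Chi124DetSets`; for `j + 1 = k`
print adds the factor `χ_k(Ω_k^{∼4})`, which must supply the input line of the core form — not treated) and nested `Ω`'s: `Chi124 … (j+1) … U′` (the NEW function `χ_k^{(n+1)}` at
`U′ = U^{(n+1)}_{k,Z}`) together with the (1.48)-bounds between `|U(∂p) − 1|` and `|U′(∂p) − 1|` on the plaquettes of the four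
printed domain families (the content of (1.44)–(1.48), r12's `B15Ineq148Proof.ineq148_of_146_147` over the leaves (1.45)–(1.47);
here hypotheses) and the printed restrictions `β₀ ≦ 1/2`, `β ≦ 1/2`, `1 ≦ L₀ < L/2`, `α ≦ 1/8`, the [III] §2 flow input `ε_{j+1}
≦ (1 + β₀)ε_j`, IMPLY `Chi124 … j … U` (the OLD function `χ_k^{(n)}` at `U = U^{(n)}_{k,Z}`) — r12's abstract-family step
`B15Claim129Step.lines124_step` AT the families `plaqsOf (region149 …)`, `plaqsOf (Ω_l∖Ω_{l+1})`, `plaqsOf (Ω^c_{k₀+1}∖Z″_{j+1})`,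
`plaqsOf (Z″_{j+1}∖Z″_j)` with the region bookkeeping `Ω^c_{k₀+1}∖Z″_j ⊆ (Ω^c_{k₀+1}∖Z″_{j+1}) ∪ (Z″_{j+1}∖Z″_j)`, `Ω_{j−1}∖Ω_{j+1} ⊆
(Ω_{j−1}∖Ω_j) ∪ (Ω_j∖Ω_{j+1})`, `Ω_j∖Ω_{j+1} ⊆ Ω_j∖Ω_{j+2}` and the exponent identities `2^{−(j+1−i+1)} = 2^{−(j−i)}/4`,
`2^{−(j−i)}/2 = 2^{−(j−i+1)}`, `L₀^{2(j−l)} = (L₀²)^{j−l}`, `c = cTop = 1`.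
§3 **`claim129_assembly`** — (1.29) AS ONE KERNEL THEOREM: over an abstract space `C` of configurations (the integration variables
and everything they determine) and the lettered data `Setting129` (which configuration-valued maps print's symbols denote —
`U^{(n)}_{k,Z}`, `U^{(n+1)}_{k,Z}`, `U_{j,□}(V_j)`, `U_{j+1,□′}(V_{j+1})`, `V_j(y,x)`, `V_j`, `V_Z^{(j)}`, `V^{(j)}_{□′}`, `A_j`,
`V^{(j)}_{Z_{j+1}∖Z_j}` — and the printed index families), `Claim129 (new129 D) (old129 χ D)` where `new129` := `χ_k^{(n+1)}`
(`Chi124` at `j+1`) ∧ `Π χ^{(j)}_{□′}` (`SF19`) ∧ `χ′_j` (`SF127`) and `old129` := (1.3) (`SF13` at `ε_j`, `L^{k−j}`) ∧ (1.4) (`SF13`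
at `ε_{j+1}`, `L^{k−j−1}`) ∧ (1.5) (`SF15`) ∧ (1.7) (`SF17`) ∧ (1.8) (`SF17` at `exp(ig_jA_j)V_seam`) ∧ `χ_k^{(n)}` (`Chi124` at `j`),
FROM exactly the printed leaves: the first inequality of (1.31) for `U_{j,□}` and `U_{j+1,□′}` ((1.30) + [III] (3.6)–(3.8); r12's
`h131`), the (3.9) [III] bound `|V_j(y,x) − 1| ≦ O(1)δ′_j` with *"O(1)δ′_j < ε_j"* (p. 184; r12's `B15Claim184` halves), the
representations (1.35), (1.40) with the `½δ_j` bounds of (1.37)–(1.39) and (1.42) (r12's `Rep135`/`Rep140` letters, existentially),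
the clause `δ′_j < ¾δ_j` of (1.43), the chart inequality (24) of [12] (`|exp iX − 1| ≦ |X|`), `g_j > 0`, and the (1.48)-bounds +
numerics of §2 — knitting BY NAME `sf13_of_131` (×2 scales), `sf17_of_reps`, `sf18_of_sf19`, `chi124_of_succ`.  The (1.6)
densities and the (1.9) functions, standing on both sides of (1.29), are not factors of `old`.
HONEST SCOPE.  (i) Bookkeeping over the factor theorems: no analytic leaf is proved here and none is weakened; every hypothesis of
`claim129_assembly` is a printed leaf already typed in the tree (located by name in the docstrings), taken for the configurations
obeying the new restrictions.  (ii) The lettered maps of `Setting129` are DATA (which objects print's symbols denote is [III] §2–§3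
∕ (1.18)–(1.27)); the families are indexed by cubes exactly as in r11's `B15Eq13Concrete` ((1.3)–(1.9), (1.88) WITH BODY at
print's index sets: its `chi13_eq_one_iff` ∕ `chi14_eq_one_iff` ∕ `chi15_eq_one_iff` ∕ `chi17_eq_one_iff` ∕ `chi18_eq_one_iff` ∕
`chi19_eq_one_iff` turn the {0,1}-valued products into the per-cube letter conditions `∀ □ ∈ X, SF13 (plaqT □) …` used in `old129` ∕
`new129`), and r11's `B15Sect1Instances` ∕ p29's `B15Sect1ChartInstances` give print's instances of `U^{(n)}_{k,Z}`, `V_Z^{(j)}`,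
`χ′_j`; none of these constructions is needed for the implication.  (iii) The (1.5) leaf enters in the GROUP form `dist1 (V_j(y,x)) ≦ C·δ′_j` (the (3.9) [III] mechanism is
r11's `B14.Ineq39` ∕ r12's `claim184_of_bondwise` in a normed ring; its `GaugeGroup` twin is not in the tree).  (iv) Case `j + 1 = k`
of (1.29) (extra factor `χ_k(Ω_k^{∼4})`) and the first case `j ≦ k₀` of (1.24) (not displayed in print, not typed by r12) are outside
§2/§3.  Unit `lit-balaban-p29` (literature-prover-lit-balaban-p29-g41-0).
-/

namespace Literature.MathematicalPhysics.QuantumFieldTheory.Balaban1983to89.B15Claim129Assembly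

open Literature.MathematicalPhysics.QuantumFieldTheory.Balaban1983to89
open B15.BasicStep B15.PrelimIntegrations B15Chi124DetSets B15Claim129Step B15SmallField185 B15StandardRep B8Eq17ClassAkV1
  GaugeField Set

variable {P : Params}

/-! ## §1  Plaquette-set bookkeeping ([I] p. 251 convention, r12/p40 `plaqsOf`) -/

/-- A plaquette with a corner in `A ∪ B` has a corner in `A` or a corner in `B`. [cite: Balaban1987RG1, (0.1) p.251] -/
theorem plaqsOf_union_subset {j : ℕ} (A B : Set (Site P j)) : plaqsOf (A ∪ B) ⊆ plaqsOf A ∪ plaqsOf B := by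
  intro p hp
  rcases hp with h1 | h2 | h3 | h4
  · rcases h1 with h | h
    · exact Or.inl (Or.inl h)
    · exact Or.inr (Or.inl h)
  · rcases h2 with h | h
    · exact Or.inl (Or.inr (Or.inl h))
    · exact Or.inr (Or.inr (Or.inl h))
  · rcases h3 with h | h
    · exact Or.inl (Or.inr (Or.inr (Or.inl h)))
    · exact Or.inr (Or.inr (Or.inr (Or.inl h)))
  · rcases h4 with h | h
    · exact Or.inl (Or.inr (Or.inr (Or.inr h)))
    · exact Or.inr (Or.inr (Or.inr (Or.inr h)))

/-- Hence: if `X ⊆ A ∪ B`, every plaquette meeting `X` meets `A` or meets `B`. [cite: Balaban1987RG1, (0.1) p.251] -/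
theorem mem_plaqsOf_or_of_subset_union {j : ℕ} {X A B : Set (Site P j)} (hX : X ⊆ A ∪ B) {p : Plaq P j}
    (hp : p ∈ plaqsOf X) : p ∈ plaqsOf A ∨ p ∈ plaqsOf B :=
  plaqsOf_union_subset A B (plaqsOf_mono hX hp)

/-! ## §2  The `χ_k^{(n)}` factor of (1.29), CONCRETE on r12's regions: `χ_k^{(n+1)}` + (1.48) ⇒ `χ_k^{(n)}` -/

section Concrete

variable {G : Type*} [GaugeGroup G]

/-- **pp. 186–187, the `χ_k^{(n)}` factor of (1.29) ON THE CONCRETE REGIONS** (*"Now consider the conditions in the definition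
(1.24) of χ_k^{(n)} … Thus taking α = 1/8 in (1.48) we satisfy all the conditions. We have proved that the function χ_k^{(n)} in
(1.29) is equal to 1."*): for `h ≦ k₀`, `k₀ + 2 ≦ j`, `j + 1 < k`, nested `Ω`'s, the NEW function `χ_k^{(n+1)}` = r12's `Chi124`
at level `j + 1` for the configuration `U′ = U^{(n+1)}_{k,Z}`, together with the (1.48)-bounds between `|U(∂p) − 1|` and
`|U′(∂p) − 1|` on the plaquettes of the printed domains — `Z″_{i+1}∖Z″_i` (`Z″_{h+1}∩Ω_h` for `i = h`) with `s = 2^{−(j−i)}`,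
`h ≦ i < j`; `Ω^c_{k₀+1}∖Z″_{j+1}`, `Ω_l∖Ω_{l+1}` (`k₀ < l ≦ j`) and `Z″_{j+1}∖Z″_j` with `s = 1` (*"the inequality (1.48), which holds
on those domains with i = j"*) — and the printed restrictions `β₀ ≦ 1/2`, `0 ≦ β ≦ 1/2`, `1 ≦ L₀ < L/2`, `0 ≦ α ≦ 1/8`, the
[III] §2 flow input `ε_{j+1} ≦ (1 + β₀)ε_j` (`ε_i ≧ 0`), IMPLY the OLD function `χ_k^{(n)}` = `Chi124` at level `j` for
`U = U^{(n)}_{k,Z}`.  r12's `B15Claim129Step.lines124_step` BY NAME at the concrete plaquette families, plus region bookkeeping.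
THIS CORE FORM (`j + 1 ≦ k`) takes the level-`(n+1)` (1.51)-line with `L₀⁰` on `Ω_j∖Ω_{j+1}` as a separate input `htopIn`: for
`j + 1 < k` it is the top line (`c = 1`) of `χ_k^{(n+1)}` itself (`chi124_of_succ`); for `j + 1 = k` print supplies it through the
extra factor `χ_k(Ω_k^{∼4})` of (1.29) (not treated here). [cite: Balaban1989LargeFieldI, (1.29) p.183, (1.24) p.182, (1.48)–(1.52) pp.186–187] -/
theorem chi124_of_succ_of_topLine (Ω Zpp : ℕ → Set (Site P 0)) {h k₀ j k : ℕ} (hk₀ : h ≤ k₀) (hj : k₀ + 2 ≤ j)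
    (hjk : j + 1 ≤ k)
    {α β β₀ L L₀ η : ℝ} {ε : ℕ → ℝ}
    (hα0 : 0 ≤ α) (hα : α ≤ 1 / 8) (hβ0 : 0 ≤ β) (hβ : β ≤ 1 / 2) (hβ₀0 : 0 ≤ β₀) (hβ₀ : β₀ ≤ 1 / 2)
    (hL : 0 < L) (hL₀1 : 1 ≤ L₀) (hL₀L : L₀ < L / 2) (hε : ∀ i, 0 ≤ ε i) (hflow : ε (j + 1) ≤ (1 + β₀) * ε j)
    {U U' : GaugeField P 0 G}
    (hnew : Chi124 Ω Zpp h k₀ (j + 1) k β L₀ ε L η U')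
    (htopIn : ∀ p ∈ plaqsOf (Ω j \ Ω (j + 1)), SF151 (dist1 (plaqHol U' p)) β 1 (E124 ε L η k (j + 1)))
    (h148Z : ∀ i, h ≤ i → i < j → ∀ p ∈ plaqsOf (region149 Ω Zpp h i),
      Ineq148 (dist1 (plaqHol U p)) (dist1 (plaqHol U' p)) α β ((1 / 2 : ℝ) ^ (j - i)) (E124 ε L η k i))
    (h148out : ∀ p ∈ plaqsOf ((Ω (k₀ + 1))ᶜ \ Zpp (j + 1)),
      Ineq148 (dist1 (plaqHol U p)) (dist1 (plaqHol U' p)) α β 1 (E124 ε L η k j))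
    (h148Ω : ∀ l, k₀ < l → l ≤ j → ∀ p ∈ plaqsOf (Ω l \ Ω (l + 1)),
      Ineq148 (dist1 (plaqHol U p)) (dist1 (plaqHol U' p)) α β 1 (E124 ε L η k j))
    (h148jj : ∀ p ∈ plaqsOf (Zpp (j + 1) \ Zpp j),
      Ineq148 (dist1 (plaqHol U p)) (dist1 (plaqHol U' p)) α β 1 (E124 ε L η k j)) :
    Chi124 Ω Zpp h k₀ j k β L₀ ε L η U := by
  obtain ⟨nZ, nOut, nΩ, -⟩ := hnew
  -- print's units `ε_i(L^{k−i}η)²` = r12's `E124 ε L η k i`, in `lines124_step`'s form `ε i * Epow i`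
  set Epow : ℕ → ℝ := fun i => (L ^ (k - i) * η) ^ 2 with hEpow_def
  have hE : ∀ i, E124 ε L η k i = ε i * Epow i := fun i => rfl
  have hEpow : ∀ i, 0 ≤ Epow i := fun i => sq_nonneg _
  have hEsucc : Epow (j + 1) = Epow j / L ^ 2 := by
    have e : k - j = (k - (j + 1)) + 1 := by omega
    simp only [hEpow_def, e, pow_succ]
    field_simp
  -- exponent bookkeeping
  have eZ : ∀ i, i < j → (1 / 2 : ℝ) ^ (j + 1 - i + 1) = (1 / 2 : ℝ) ^ (j - i) / 4 := by
    intro i hi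
    rw [show j + 1 - i + 1 = (j - i) + 2 by omega, pow_add]
    ring
  have eZ' : ∀ i, i < j → (1 / 2 : ℝ) ^ (j - i) / 2 = (1 / 2 : ℝ) ^ (j - i + 1) := by
    intro i _
    rw [pow_succ]
    ring
  have ejj : (1 / 2 : ℝ) ^ (j + 1 - j + 1) = 1 / 4 := by
    rw [show j + 1 - j + 1 = 2 by omega]
    norm_num
  have hcTop0 : cTop j k = 1 := by
    have : j < k := by omega
    simp [cTop, this]
  -- the three plaquette families of `lines124_step`
  let SZ : ℕ → Set (Plaq P 0) := fun i => plaqsOf (region149 Ω Zpp h i)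
  let SΩ : ℕ → Set (Plaq P 0) := fun l => if l = k₀ then plaqsOf ((Ω (k₀ + 1))ᶜ \ Zpp (j + 1)) else plaqsOf (Ω l \ Ω (l + 1))
  let Sjj : Set (Plaq P 0) := plaqsOf (Zpp (j + 1) \ Zpp j)
  have step := lines124_step (fun p => dist1 (plaqHol U p)) (fun p => dist1 (plaqHol U' p)) (h := h) (k₀ := k₀) (j := j)
    ε Epow hα0 hα hβ0 hβ hβ₀0 hβ₀ hL hL₀1 hL₀L hε hEpow hflow hEsucc SZ SΩ Sjj ?hZ ?hΩ ?hjj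
  case hZ =>
    intro i hi hij p hp
    refine ⟨?_, h148Z i hi hij p hp⟩
    have h1 := nZ i hi (by omega) p hp
    rw [eZ i hij] at h1
    exact h1
  case hΩ =>
    intro l hl hlj p hp
    by_cases hlk : l = k₀
    · subst hlk
      have hp' : p ∈ plaqsOf ((Ω (l + 1))ᶜ \ Zpp (j + 1)) := by simpa [SΩ] using hp
      refine ⟨?_, h148out p hp'⟩
      have h1 := nOut p hp'
      rw [show j + 1 - l - 1 = j - l by omega] at h1
      exact h1
    · have hp' : p ∈ plaqsOf (Ω l \ Ω (l + 1)) := by simpa [SΩ, hlk] using hp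
      have hkl : k₀ < l := lt_of_le_of_ne hl (Ne.symm hlk)
      refine ⟨?_, h148Ω l hkl hlj p hp'⟩
      rcases Nat.lt_or_ge l j with hlt | hge
      · -- an `Ω`-line of `χ_k^{(n+1)}`
        have h1 := nΩ l hkl (by omega) p hp'
        rw [show 2 * (j + 1 - l - 1) = 2 * (j - l) by omega, pow_mul] at h1
        exact h1
      · -- `l = j`: the input line `htopIn` on `Ω_j∖Ω_{j+1}`
        have hl_eq : l = j := le_antisymm hlj hge
        subst hl_eq
        have h1 := htopIn p hp'
        rw [Nat.sub_self, pow_zero]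
        exact h1
  case hjj =>
    intro p hp
    refine ⟨?_, h148jj p hp⟩
    have hjh : j ≠ h := by omega
    have hp' : p ∈ plaqsOf (region149 Ω Zpp h j) := by rwa [region149_of_ne Ω Zpp hjh]
    have h1 := nZ j (by omega) (by omega) p hp'
    rw [ejj] at h1
    exact h1
  -- read off the four line families of `χ_k^{(n)}`
  obtain ⟨oZ, oΩ, ojj⟩ := step
  refine ⟨?_, ?_, ?_, ?_⟩
  · -- (i) the `Z″`-lines
    intro i hi hij p hp
    have h1 := oZ i hi hij p hp
    rw [eZ' i hij] at h1
    exact h1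
  · -- (ii) the outer line on `Ω^c_{k₀+1}∖Z″_j ⊆ (Ω^c_{k₀+1}∖Z″_{j+1}) ∪ (Z″_{j+1}∖Z″_j)`
    intro p hp
    have hcover : (Ω (k₀ + 1))ᶜ \ Zpp j ⊆ ((Ω (k₀ + 1))ᶜ \ Zpp (j + 1)) ∪ (Zpp (j + 1) \ Zpp j) := by
      intro x hx
      by_cases hx1 : x ∈ Zpp (j + 1)
      · exact Or.inr ⟨hx1, hx.2⟩
      · exact Or.inl ⟨hx.1, hx1⟩
    rcases mem_plaqsOf_or_of_subset_union hcover hp with hp1 | hp2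
    · have h1 := oΩ k₀ le_rfl (by omega) p (by simpa [SΩ] using hp1)
      exact h1
    · exact ojj p hp2
  · -- (iii) the `Ω`-lines, `k₀ < l ≦ j − 2`
    intro l hl hlj p hp
    have hlk : l ≠ k₀ := by omega
    have h1 := oΩ l hl.le (by omega) p (by simpa [SΩ, hlk] using hp)
    rw [← pow_mul] at h1
    exact h1
  · -- (iv) the top line (`c = 1`) on `Ω_{j−1}∖Ω_{j+1} ⊆ (Ω_{j−1}∖Ω_j) ∪ (Ω_j∖Ω_{j+1})`
    intro p hp
    rw [hcTop0]
    have hcover : Ω (j - 1) \ Ω (j + 1) ⊆ (Ω (j - 1) \ Ω (j - 1 + 1)) ∪ (Ω j \ Ω (j + 1)) := by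
      intro x hx
      rw [show j - 1 + 1 = j by omega]
      by_cases hxj : x ∈ Ω j
      · exact Or.inr ⟨hxj, hx.2⟩
      · exact Or.inl ⟨hx.1, hxj⟩
    unfold SF124c
    rw [hE]
    rcases mem_plaqsOf_or_of_subset_union hcover hp with hp1 | hp2
    · have hne : j - 1 ≠ k₀ := by omega
      have h1 := oΩ (j - 1) (by omega) (by omega) p (by simpa [SΩ, hne] using hp1)
      unfold SF151 at h1
      rw [show j - (j - 1) - 1 = 0 by omega, pow_zero] at h1
      linarith
    · have hne : j ≠ k₀ := by omega
      have h1 := oΩ j (by omega) le_rfl p (by simpa [SΩ, hne] using hp2)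
      unfold SF151 at h1
      rw [Nat.sub_self, pow_zero] at h1
      linarith

/-- **The `χ_k^{(n)}` factor of (1.29) for `j + 1 < k`** (print's main case): as `chi124_of_succ_of_topLine`, the input line on
`Ω_j∖Ω_{j+1}` being now the top line (`c = cTop (j+1) k = 1`) of `χ_k^{(n+1)}` on `Ω_j∖Ω_{j+2} ⊇ Ω_j∖Ω_{j+1}` (nested `Ω`'s).
[cite: Balaban1989LargeFieldI, (1.29) p.183, (1.24) p.182, pp.186–187] -/
theorem chi124_of_succ (Ω Zpp : ℕ → Set (Site P 0)) {h k₀ j k : ℕ} (hk₀ : h ≤ k₀) (hj : k₀ + 2 ≤ j) (hjk : j + 1 < k)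
    (hΩ : ∀ i, Ω (i + 1) ⊆ Ω i)
    {α β β₀ L L₀ η : ℝ} {ε : ℕ → ℝ}
    (hα0 : 0 ≤ α) (hα : α ≤ 1 / 8) (hβ0 : 0 ≤ β) (hβ : β ≤ 1 / 2) (hβ₀0 : 0 ≤ β₀) (hβ₀ : β₀ ≤ 1 / 2)
    (hL : 0 < L) (hL₀1 : 1 ≤ L₀) (hL₀L : L₀ < L / 2) (hε : ∀ i, 0 ≤ ε i) (hflow : ε (j + 1) ≤ (1 + β₀) * ε j)
    {U U' : GaugeField P 0 G}
    (hnew : Chi124 Ω Zpp h k₀ (j + 1) k β L₀ ε L η U')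
    (h148Z : ∀ i, h ≤ i → i < j → ∀ p ∈ plaqsOf (region149 Ω Zpp h i),
      Ineq148 (dist1 (plaqHol U p)) (dist1 (plaqHol U' p)) α β ((1 / 2 : ℝ) ^ (j - i)) (E124 ε L η k i))
    (h148out : ∀ p ∈ plaqsOf ((Ω (k₀ + 1))ᶜ \ Zpp (j + 1)),
      Ineq148 (dist1 (plaqHol U p)) (dist1 (plaqHol U' p)) α β 1 (E124 ε L η k j))
    (h148Ω : ∀ l, k₀ < l → l ≤ j → ∀ p ∈ plaqsOf (Ω l \ Ω (l + 1)),
      Ineq148 (dist1 (plaqHol U p)) (dist1 (plaqHol U' p)) α β 1 (E124 ε L η k j))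
    (h148jj : ∀ p ∈ plaqsOf (Zpp (j + 1) \ Zpp j),
      Ineq148 (dist1 (plaqHol U p)) (dist1 (plaqHol U' p)) α β 1 (E124 ε L η k j)) :
    Chi124 Ω Zpp h k₀ j k β L₀ ε L η U := by
  refine chi124_of_succ_of_topLine Ω Zpp hk₀ hj hjk.le hα0 hα hβ0 hβ hβ₀0 hβ₀ hL hL₀1 hL₀L hε hflow hnew ?_
    h148Z h148out h148Ω h148jj
  -- the top line of `χ_k^{(n+1)}` (`c = 1` since `j + 1 < k`) restricted to `Ω_j∖Ω_{j+1} ⊆ Ω_j∖Ω_{j+2}`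
  intro p hp
  have hsub : Ω j \ Ω (j + 1) ⊆ Ω (j + 1 - 1) \ Ω (j + 1 + 1) := by
    rw [Nat.add_sub_cancel]
    exact fun x hx => ⟨hx.1, fun hx2 => hx.2 (hΩ (j + 1) hx2)⟩
  have h1 := hnew.2.2.2 p (plaqsOf_mono hsub hp)
  have hcTop1 : cTop (j + 1) k = 1 := by simp [cTop, hjk]
  rw [hcTop1] at h1
  unfold SF124c at h1
  unfold SF151
  linarith

end Concrete

/-! ## §3  (1.29) as ONE kernel theorem: `Claim129 new old`, `old` = all six factor families -/

section Assembly

/-- THE LETTERED DATA OF (1.29) over an abstract space `C` of configurations (the integration variables `V_j`, `A_j`, … and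
everything they determine): which configuration each printed symbol denotes, and the printed index families.  `Ω i`, `Zpp i` =
the regions `Ω_i`, `Z″_i ⊂ T_η` (r12's point-set model `B15DeterminingSets`); `h`, `k₀ = k − N₀`, `k` the scales (the level is
`n = j − h`); `β`, `L₀`, `L`, `η`, `ε i = ε_i`, `gj = g_j`, `δj = δ_j`, `δ'j = δ′_j` the printed numbers; `UnZ U = U^{(n)}_{k,Z}`,
`Un1Z U = U^{(n+1)}_{k,Z}` ((1.20)); the families are indexed BY CUBES as in print and in r11's concrete instances `B15Eq13Concrete`
(`κ` = the `LM₂R_j`-cubes `□` of `T_{L^{−j}}`, `κ'` = the cubes `□′` of `T_{L^{−j−1}}`): `plaqT □` = the plaquettes of `□^∼`, `cubes13` =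
the cubes `□ ⊂ (Ω_j^{∼4}∖Ω^∼_{j+1})∩Z` of (1.3) with `Ubox13 U □ = U_{j,□}(V_j)`; `plaqT' □′`, `cubes14`, `Ubox14 U □′ = U_{j+1,□′}(V_{j+1})`
the same for (1.4); `S15` = the pairs `(y, x)`, `x ∈ B(y)`, `x ≠ y` of (1.5) (both printed ranges of `y`) with `V15 U (y,x) =
V_j(y,x)`; `S27` = the bond set `(Ω^c_{j+1}∖Z″_{j+1})^{(j)*}` of (1.27) with `Vj U = V_j`, `VZ U = V_Z^{(j)}` ((1.26)); `bondsStar □′`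
= the bond set `(□′^{∼2})*`; `cubes7` = the cubes `□′ ⊂ Ω^{∼2}_{j+1}∖Ω_{j+1}` of (1.7), `cubes8` = the cubes `□′ ⊂ (Ω_{j+1}∖Λ^∼_{j+1})∩Z`
of (1.8), with `Vbox U □′ = V^{(j)}_{□′}` ([III] (3.4)) and `Vseam U = V^{(j)}_{Z_{j+1}∖Z_j}` ((1.33)); `cubes9` = the cubes `□′ ⊂
Z_{j+1}∩Ω_{j+1}` of the completed (1.9)-product ((1.28)) with `Aj U = A_j`.  DATA only (HONEST SCOPE (ii)).
[cite: Balaban1989LargeFieldI, (1.29) p.183] -/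
structure Setting129 (P : Params) (G 𝔤 C κ κ' : Type*) (j : ℕ) where
  Ω : ℕ → Set (Site P 0)
  Zpp : ℕ → Set (Site P 0)
  h : ℕ
  k₀ : ℕ
  k : ℕ
  β : ℝ
  L₀ : ℝ
  L : ℝ
  η : ℝ
  ε : ℕ → ℝ
  gj : ℝ
  δj : ℝ
  δ'j : ℝ
  UnZ : C → GaugeField P 0 G
  Un1Z : C → GaugeField P 0 G
  plaqT : κ → Set (Plaq P 0)
  cubes13 : Set κ
  Ubox13 : C → κ → GaugeField P 0 G
  plaqT' : κ' → Set (Plaq P 0)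
  cubes14 : Set κ'
  Ubox14 : C → κ' → GaugeField P 0 G
  S15 : Set (Site P (j + 1) × Site P j)
  V15 : C → Site P (j + 1) × Site P j → G
  S27 : Set (PBond P j)
  Vj : C → GaugeField P j G
  VZ : C → GaugeField P j G
  bondsStar : κ' → Set (PBond P j)
  cubes7 : Set κ'
  cubes8 : Set κ'
  cubes9 : Set κ'
  Vbox : C → κ' → GaugeField P j G
  Vseam : C → GaugeField P j G
  Aj : C → VecField P j 𝔤

variable {G : Type*} [GaugeGroup G] {𝔤 : Type*} [NormedAddCommGroup 𝔤] [NormedSpace ℝ 𝔤] {C κ κ' : Type*} {j : ℕ}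

/-- **THE NEW RESTRICTIONS of (1.29)** (its right-hand side without the gauge-fixing densities): `χ_k^{(n+1)}` = (1.24) at level
`j + 1` for `U^{(n+1)}_{k,Z}` (r12's `Chi124`), the product `Π_{□′⊂Z_{j+1}∩Ω_{j+1}} χ^{(j)}_{□′}` of the (1.9)-functions
`|A_j(b)| < g_j⁻¹δ_j` on `(□′^{∼2})*` (r12's `SF19` per cube, as r11's `chi19_eq_one_iff`), and `χ′_j` = (1.27) (r12's `SF127`). [cite: Balaban1989LargeFieldI, (1.29) p.183] -/
def new129 (D : Setting129 P G 𝔤 C κ κ' j) (U : C) : Prop :=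
  Chi124 D.Ω D.Zpp D.h D.k₀ (j + 1) D.k D.β D.L₀ D.ε D.L D.η (D.Un1Z U) ∧
  (∀ c ∈ D.cubes9, SF19 (D.bondsStar c) D.gj D.δj (D.Aj U)) ∧
  SF127 D.S27 D.δ'j (D.Vj U) (D.VZ U)

/-- **THE OLD FUNCTIONS of (1.29)** — *"the functions (1.3), (1.4), (1.5), (1.7), (1.8), χ_k^{(n)}"* — as ONE conjunction of
r12's letters: (1.3) `SF13` at `ε_j`, `L^{k−j}` for every `U_{j,□}(V_j)`; (1.4) `SF13` at `ε_{j+1}`, `L^{k−j−1}` for every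
`U_{j+1,□′}(V_{j+1})`; (1.5) `SF15` (`|V_j(y,x) − 1| < ε_j`); (1.7) `SF17` (`|V_j(b)(V^{(j)}_{□′}(b))⁻¹ − 1| < 2δ_j`); (1.8) `SF17`
for `exp(ig_jA_j)V^{(j)}_{Z_{j+1}∖Z_j}` against `V^{(j)}_{□′}`; `χ_k^{(n)}` = `Chi124` at level `j` for `U^{(n)}_{k,Z}`.
[cite: Balaban1989LargeFieldI, (1.29) p.183] -/
def old129 (χ : LieChart G 𝔤) (D : Setting129 P G 𝔤 C κ κ' j) (U : C) : Prop :=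
  (∀ c ∈ D.cubes13, SF13 (D.plaqT c) (D.ε j) (D.L ^ (D.k - j)) D.η (D.Ubox13 U c)) ∧
  (∀ c ∈ D.cubes14, SF13 (D.plaqT' c) (D.ε (j + 1)) (D.L ^ (D.k - (j + 1))) D.η (D.Ubox14 U c)) ∧
  SF15 D.S15 (D.ε j) (D.V15 U) ∧
  (∀ c ∈ D.cubes7, SF17 (D.bondsStar c) D.δj (D.Vj U) (D.Vbox U c)) ∧
  (∀ c ∈ D.cubes8, SF17 (D.bondsStar c) D.δj (expMul χ D.gj (D.Aj U) (D.Vseam U)) (D.Vbox U c)) ∧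
  Chi124 D.Ω D.Zpp D.h D.k₀ j D.k D.β D.L₀ D.ε D.L D.η (D.UnZ U)

/-- **(1.29) p. 183 — THE ONE-THEOREM ASSEMBLY** (*"the restrictions introduced by the new characteristic functions imply that
the functions (1.3), (1.4), (1.5), (1.7), (1.8), χ_k^{(n)} are equal to 1"*; p. 187 *"This completes the proof of the equality
(1.29)"*), `j + 1 < k`, in the typed form `B15.BasicStep.Claim129 (new129 D) (old129 χ D)`, FROM THE PRINTED LEAVES taken for the
configurations obeying the new restrictions: `L131`/`L131'` = the first inequality of (1.31) for `U_{j,□}(V_j)` (p. 184 *"Estimating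
∂U_{j,□} as in (3.8) [III]"* from (1.30) and *"the last inequality in (1.24) (with c = 1)"* for `U_k^{(n)}` — hence stated GIVEN
`χ_k^{(n)}`) and for `U_{j+1,□′}(V_{j+1})` (*"the argument above applies to an arbitrary j"*); `L39` + `hC15` = p. 184 *"we use the
inequality (3.9) [III] … From the restrictions (1.27) we get the bound O(1)δ′_j < ε_j"* (the bound `|V_j(y,x) − 1| ≦ O(1)δ′_j` and
the smallness, r12's `B15Claim184` halves; HONEST SCOPE (iii)); `L17` = for (1.7): `□′^{∼2}`-bonds inside the (1.27) range, the
representation (1.40) (r12's `Rep140`) with the (1.42) bound `|exp iℍ^{(j)}_{□′}(b) − 1| < ½δ_j`, and `hδ` = `2δ′_j + ½δ_j < 2δ_j`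
((1.43)); `L18` = for (1.8): the representations (1.35), (1.40) (r12's `Rep135`, `Rep140`) with the `½δ_j` bounds of (1.37)–(1.39)
and (1.42), `hchart` = (24) of [12] `|exp iX − 1| ≦ |X|`, `hg` = `g_j > 0`, `hS89` = the (1.8)-bonds lie where `A_j` is
restricted (p. 184 *"the restrictions introduced by the functions χ^{(j)}_{□′} in (1.29) imply the bound … (1.32)"*); `L148` = the (1.48)-bounds of pp. 186–187 on the four
domain families (leaves (1.45)–(1.47) via r12's `ineq148_of_146_147`); numerics as printed (`0 < β ≦ 1/2`, `0 ≦ ε_i`, `ε_j,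
ε_{j+1} ≦ 1`, `ε_j(L^{k−j}η) ≦ L⁻²`, `ε_{j+1}(L^{k−j−1}η) ≦ L⁻²`, `L ≧ 2`, `η ≧ 0`, `β₀ ≦ 1/2`, `1 ≦ L₀ < L/2`, `0 ≦ α ≦ 1/8`,
`ε_{j+1} ≦ (1+β₀)ε_j`; scales `h ≦ k₀`, `k₀ + 2 ≦ j`, nested `Ω`'s).  Knits BY NAME: `B15SmallField185.sf13_of_131` (×2),
`sf17_of_reps`, `sf18_of_sf19`, §2 `chi124_of_succ` (→ r12's `lines124_step`). [cite: Balaban1989LargeFieldI, (1.29) p.183, pp.184–187] -/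
theorem claim129_assembly (χ : LieChart G 𝔤) (D : Setting129 P G 𝔤 C κ κ' j)
    -- scales and geometry
    (hk₀ : D.h ≤ D.k₀) (hj : D.k₀ + 2 ≤ j) (hjk : j + 1 < D.k) (hΩ : ∀ i, D.Ω (i + 1) ⊆ D.Ω i)
    -- printed numerics
    {α β₀ : ℝ} (hα0 : 0 ≤ α) (hα : α ≤ 1 / 8) (hβ0 : 0 < D.β) (hβ : D.β ≤ 1 / 2) (hβ₀0 : 0 ≤ β₀) (hβ₀ : β₀ ≤ 1 / 2)
    (hL2 : 2 ≤ D.L) (hL₀1 : 1 ≤ D.L₀) (hL₀L : D.L₀ < D.L / 2) (hη : 0 ≤ D.η) (hε : ∀ i, 0 ≤ D.ε i)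
    (hε1 : D.ε j ≤ 1) (hε1' : D.ε (j + 1) ≤ 1) (hεξ : D.ε j * (D.L ^ (D.k - j) * D.η) ≤ (D.L ^ 2)⁻¹)
    (hεξ' : D.ε (j + 1) * (D.L ^ (D.k - (j + 1)) * D.η) ≤ (D.L ^ 2)⁻¹) (hflow : D.ε (j + 1) ≤ (1 + β₀) * D.ε j)
    (hg : 0 < D.gj) (hδ : D.δ'j < 3 / 4 * D.δj) (hchart : ∀ X : 𝔤, dist1 (χ.expI X) ≤ ‖X‖)
    (hS89 : ∀ c ∈ D.cubes8, D.bondsStar c ⊆ ⋃ c' ∈ D.cubes9, D.bondsStar c')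
    -- the printed leaves, for the configurations obeying the new restrictions
    (L131 : ∀ U, new129 D U → Chi124 D.Ω D.Zpp D.h D.k₀ j D.k D.β D.L₀ D.ε D.L D.η (D.UnZ U) →
      ∀ c ∈ D.cubes13, ∀ p ∈ D.plaqT c, dist1 (plaqHol (D.Ubox13 U c) p) < expr131a D.β (D.ε j) (D.L ^ (D.k - j) * D.η))
    (L131' : ∀ U, new129 D U →
      ∀ c ∈ D.cubes14, ∀ p ∈ D.plaqT' c,
        dist1 (plaqHol (D.Ubox14 U c) p) < expr131a D.β (D.ε (j + 1)) (D.L ^ (D.k - (j + 1)) * D.η))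
    {C15 : ℝ} (hC15 : C15 * D.δ'j < D.ε j)
    (L39 : ∀ U, new129 D U → ∀ c ∈ D.S15, dist1 (D.V15 U c) ≤ C15 * D.δ'j)
    (L17 : ∀ U, new129 D U → ∀ c ∈ D.cubes7, D.bondsStar c ⊆ D.S27 ∧
      ∃ (Mt MjUn1 : GaugeField P j G) (ubR : GaugeTransf P j G) (Hbox : VecField P j 𝔤),
        Rep140 χ Mt MjUn1 (D.VZ U) (D.Vbox U c) ubR Hbox ∧ ∀ b ∈ D.bondsStar c, dist1 (χ.expI (Hbox b)) < D.δj / 2)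
    (L18 : ∀ U, new129 D U → ∀ c ∈ D.cubes8,
      ∃ (Mt MjUn1 : GaugeField P j G) (ujR : GaugeTransf P j G) (Hj : VecField P j 𝔤)
        (Mt' MjUn1' : GaugeField P j G) (ubR : GaugeTransf P j G) (Hbox : VecField P j 𝔤),
        Rep135 χ Mt MjUn1 (D.VZ U) (D.Vseam U) ujR Hj ∧ Rep140 χ Mt' MjUn1' (D.VZ U) (D.Vbox U c) ubR Hbox ∧
          (∀ b ∈ D.bondsStar c, dist1 (χ.expI (Hj b)) < D.δj / 2) ∧
          (∀ b ∈ D.bondsStar c, dist1 (χ.expI (Hbox b)) < D.δj / 2))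
    (L148 : ∀ U, new129 D U →
      (∀ i, D.h ≤ i → i < j → ∀ p ∈ plaqsOf (region149 D.Ω D.Zpp D.h i),
        Ineq148 (dist1 (plaqHol (D.UnZ U) p)) (dist1 (plaqHol (D.Un1Z U) p)) α D.β ((1 / 2 : ℝ) ^ (j - i))
          (E124 D.ε D.L D.η D.k i)) ∧
      (∀ p ∈ plaqsOf ((D.Ω (D.k₀ + 1))ᶜ \ D.Zpp (j + 1)),
        Ineq148 (dist1 (plaqHol (D.UnZ U) p)) (dist1 (plaqHol (D.Un1Z U) p)) α D.β 1 (E124 D.ε D.L D.η D.k j)) ∧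
      (∀ l, D.k₀ < l → l ≤ j → ∀ p ∈ plaqsOf (D.Ω l \ D.Ω (l + 1)),
        Ineq148 (dist1 (plaqHol (D.UnZ U) p)) (dist1 (plaqHol (D.Un1Z U) p)) α D.β 1 (E124 D.ε D.L D.η D.k j)) ∧
      (∀ p ∈ plaqsOf (D.Zpp (j + 1) \ D.Zpp j),
        Ineq148 (dist1 (plaqHol (D.UnZ U) p)) (dist1 (plaqHol (D.Un1Z U) p)) α D.β 1 (E124 D.ε D.L D.η D.k j))) :
    Claim129 (new129 D) (old129 χ D) := by
  intro U hU
  have hU' := hU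
  obtain ⟨h124', h19, h127⟩ := hU'
  have hL : 0 < D.L := by linarith
  have hβ1 : D.β ≤ 1 := by linarith
  -- the factor `χ_k^{(n)}` first (pp. 186–187): it is used by the (1.3)-argument of p. 183
  obtain ⟨h148Z, h148out, h148Ω, h148jj⟩ := L148 U hU
  have hχn : Chi124 D.Ω D.Zpp D.h D.k₀ j D.k D.β D.L₀ D.ε D.L D.η (D.UnZ U) :=
    chi124_of_succ D.Ω D.Zpp hk₀ hj hjk hΩ hα0 hα hβ0.le hβ hβ₀0 hβ₀ hL hL₀1 hL₀L hε hflow h124' h148Z h148out h148Ω h148jj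
  refine ⟨?_, ?_, ?_, ?_, ?_, hχn⟩
  · -- (1.3), p. 184: the first inequality of (1.31) ⇒ `SF13` (`sf13_of_131`)
    intro c hc
    exact sf13_of_131 (L131 U hU hχn c hc) hβ0 hβ1 (hε j) hε1 (mul_nonneg (pow_nonneg hL.le _) hη) hεξ hL2
  · -- (1.4): *"the argument above applies to an arbitrary j"*
    intro c hc
    exact sf13_of_131 (L131' U hU c hc) hβ0 hβ1 (hε (j + 1)) hε1' (mul_nonneg (pow_nonneg hL.le _) hη) hεξ' hL2
  · -- (1.5), p. 184: `|V_j(y,x) − 1| ≦ O(1)δ′_j < ε_j`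
    intro c hc
    exact lt_of_le_of_lt (L39 U hU c hc) hC15
  · -- (1.7), p. 185: (1.43) from (1.27), (1.40), (1.42) (`sf17_of_reps`)
    intro c hc
    obtain ⟨hSS, Mt, MjUn1, ubR, Hbox, h140, h142⟩ := L17 U hU c hc
    exact sf17_of_reps χ hSS h127 h140 h142 hδ
  · -- (1.8), pp. 184–185: (1.32) + (1.39) + (1.42) from (1.9), (1.35), (1.40) (`sf18_of_sf19`)
    intro c hc
    obtain ⟨Mt, MjUn1, ujR, Hj, Mt', MjUn1', ubR, Hbox, h135, h140, h137, h142⟩ := L18 U hU c hc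
    -- p. 184 (1.32): the (1.9)-functions bound `A_j` on all of `(Z_{j+1}∩Ω_{j+1})^{(j)} ⊇ (□′^{∼2})*`
    have h19c : SF19 (D.bondsStar c) D.gj D.δj (D.Aj U) := fun b hb => by
      obtain ⟨c', hc', hb'⟩ := Set.mem_iUnion₂.1 (hS89 c hc hb)
      exact h19 c' hc' b hb'
    exact sf18_of_sf19 χ hchart hg h19c h135 h140 (fun b hb => (h137 b hb).le) (fun b hb => (h142 b hb).le)

open Classical in
/-- (1.29) IN THE PRINTED FORM — an equality of products of characteristic functions, *"(new factors)·(old factors) = (new factors)"*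
— through r12's `claim129_iff_indicator`. [cite: Balaban1989LargeFieldI, (1.29) p.183] -/
theorem claim129_assembly_indicator (χ : LieChart G 𝔤) (D : Setting129 P G 𝔤 C κ κ' j)
    (h : Claim129 (new129 D) (old129 χ D)) (U : C) :
    (if new129 D U then (1 : ℝ) else 0) * (if old129 χ D U then 1 else 0) = if new129 D U then 1 else 0 :=
  (claim129_iff_indicator (new129 D) (old129 χ D)).1 h U

end Assembly

end Literature.MathematicalPhysics.QuantumFieldTheory.Balaban1983to89.B15Claim129Assembly
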